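/-
Copyright (c) 2026. All rights reserved.
Released under Apache 2.0 license as described in the file LICENSE.
Authors: abc-iut cell — seat abc-iut-w5-d058 (wave 5; §4(iii) non-vacuity programme, layer L4: rider to
`GaloisTheatersNonVacuity.lean` — functoriality data of the point datum; the Rmk 5.10.1 (i) slot record).
-/
import Literature.AnabelianGeometry.AbsoluteAnabelian.GaloisTheatersNonVacuity
import Literature.AnabelianGeometry.AbsoluteAnabelian.RelativeGCFunctoriality
import Literature.AnabelianGeometry.AbsoluteAnabelian.AbsTopIII.RemarksLogShells
import HarnessLib

/-!
# The one-object point datum is functorial; `RelativeAnabelianDatum.Functoriality`, `Rmk5101Setting` inhabited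

S. Mochizuki, *The local pro-p anabelian geometry of curves* [MochizukiLocAn1999], Thm A p. 3 and remark (3);
*Topics in absolute anabelian geometry I* [MochizukiAbsTopI2012], Def 4.6 p. 55; *… III* [MochizukiAbsTopIII2015],
Rmk 5.10.1 (i) p. 149.

PROOF-ONLY rider (no `def` / `instance` / `structure`) to `GaloisTheatersNonVacuity.lean` (p423873): abc-iut-w5-d197's
INHABITATION-CENSUS-L4 v1 lists `RelativeAnabelianDatum.Functoriality` (the functoriality DATA — identities,
composition, the two laws of `f ↦ [π₁(f)]`, invertibility ↔ `IsIso` — over which `RelativeGCFunctoriality.lean` turns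
[pGC] remark (3) into the theorem `relIsomGC_of_relHomGC`) and `AbsTopIII.Rmk5101Setting` (the slot record of the
Rmk 5.10.1 (i) homotopy manipulation) with ZERO producers.

* `RelativeAnabelianDatum.exists_point_functoriality` — the one-object datum over the point `Π = G ↠ G` (one morphism,
  declared an isomorphism and a hyperbolic curve, `f ↦ [id]`) CARRIES functoriality data, and its `RelHomGC` holds,
  so `relIsomGC_of_relHomGC` APPLIES to it (and re-proves its `RelIsomGC`): the hypothesis package
  «functorial datum + rel-hom-GC» of [pGC] remark (3) is jointly satisfiable (DEGENERATE: `Δ = 1`);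
* `AbsTopI.ConstructionDataClass.exists_functorial_relHomDGC` — a class all of whose data are functorial with
  chain-full ∧ rel-hom-DGC (hence rel-isom-DGC by `relIsomDGC_of_relHomDGC`): the hypothesis list of
  `ex_4_8_i_of_relHomDGC` is jointly satisfiable (DEGENERATE: one base field `ℚ`, the point datum);
* `AbsTopIII.Rmk5101Setting.nonempty_self` — the slot record at five copies of one category with identity arrows and
  identity homotopies (the record carries no law beyond its two given natural isomorphisms).

HONEST LABEL: SATISFIABILITY witnesses at DEGENERATE data, nothing about curves; nothing of [pGC] / [AbsTopI] /
[AbsTopIII] is asserted; instantiated ≠ endorsed; nothing here bears on the disputed [IUTchIII] Cor. 3.12.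
-/

namespace Literature.AnabelianGeometry.AbsoluteAnabelian

open CategoryTheory

universe u

/-- **The point datum is functorial, satisfies rel-hom-GC, hence (by [pGC] remark (3) as the theorem
`relIsomGC_of_relHomGC`) rel-isom-GC.**  DEGENERATE (`Δ = 1`; `OuterHom` over the point is a singleton,
`AugmentedProfiniteGrp.outerHom_point_eq`). [cite: MochizukiLocAn1999, Thm A p.3] -/
theorem RelativeAnabelianDatum.exists_point_functoriality (G : ProfiniteGrp.{u}) :
    ∃ D : RelativeAnabelianDatum G, Nonempty D.Functoriality ∧ (∀ X, D.IsHyperbolicCurve X) ∧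
      D.primes = Set.univ ∧ D.RelHomGC ∧ D.RelIsomGC := by
  let A : AugmentedProfiniteGrp G :=
    { arith := G, aug := ContinuousMonoidHom.id G, aug_surjective := Function.surjective_id }
  let ι : A.HomOver A := ⟨ContinuousMonoidHom.id _, fun _ => rfl⟩
  let D : RelativeAnabelianDatum G :=
    { Obj := PUnit.{u + 1}, Hom := fun _ _ => PUnit.{u + 1}, IsIso := fun _ => True,
      IsHyperbolicCurve := fun _ => True, primes := Set.univ, grp := fun _ => A,
      outerHom := fun _ => AugmentedProfiniteGrp.OuterHom.mk ι }
  have hF : Nonempty D.Functoriality :=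
    ⟨{ id := fun _ => PUnit.unit
       comp := fun _ _ => PUnit.unit
       outerHom_id := fun _ => AugmentedProfiniteGrp.outerHom_point_eq _ _
       outerHom_comp := fun _ _ => AugmentedProfiniteGrp.outerHom_point_eq _ _
       isIso_iff := fun _ => ⟨fun _ => ⟨PUnit.unit, rfl, rfl⟩, fun _ => trivial⟩ }⟩
  have hHom : D.RelHomGC := by
    intro X Y _
    refine ⟨fun _ _ => ?_, fun _ _ _ _ _ => Subsingleton.elim _ _, fun c _ => ⟨PUnit.unit, trivial, ?_⟩⟩
    · show (AugmentedProfiniteGrp.OuterHom.mk ι).IsOpen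
      rw [AugmentedProfiniteGrp.OuterHom.isOpen_mk, AugmentedProfiniteGrp.HomOver.IsOpenHom]
      have : Set.range (ι.toHom) = Set.univ := Set.range_eq_univ.mpr Function.surjective_id
      rw [this]
      exact isOpen_univ
    · exact AugmentedProfiniteGrp.outerHom_point_eq _ _
  obtain ⟨F⟩ := hF
  exact ⟨D, ⟨F⟩, fun _ => trivial, rfl, hHom, RelativeAnabelianDatum.relIsomGC_of_relHomGC F hHom⟩

/-- **A class of construction data all of whose data are functorial, chain-full, with rel-hom-DGC — hence
rel-isom-DGC** (`AbsTopI.ConstructionDataClass.relIsomDGC_of_relHomDGC`): one base field `ℚ`, the functorial point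
datum over `G_ℚ`, every object a member and a hyperbolic orbicurve, no chain terms.  DEGENERATE.
[cite: MochizukiAbsTopI2012, Def 4.6 (i)(ii) pp.55–56] -/
theorem AbsTopI.ConstructionDataClass.exists_functorial_relHomDGC :
    ∃ 𝒟 : AbsTopI.ConstructionDataClass.{0}, (∀ b, Nonempty (𝒟.datum b).Functoriality) ∧
      𝒟.IsChainFull ∧ 𝒟.RelHomDGC ∧ 𝒟.RelIsomDGC := by
  obtain ⟨D, ⟨F⟩, hhyp, -, hHom, -⟩ := RelativeAnabelianDatum.exists_point_functoriality (absoluteGaloisGrp ℚ)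
  let 𝒟 : AbsTopI.ConstructionDataClass.{0} :=
    { Base := PUnit.{1}
      fld := fun _ => ℚ
      instField := fun _ => inferInstance
      instCharZero := fun _ => inferInstance
      datum := fun _ => D
      Mem := fun _ _ => True
      IsHyperbolicOrbicurve := fun _ _ => True
      isHyperbolicOrbicurve_of_isHyperbolicCurve := fun _ _ _ => trivial
      chainTerms := fun _ _ => ∅ }
  have hF : ∀ b, Nonempty (𝒟.datum b).Functoriality := fun _ => ⟨F⟩
  have hHomD : 𝒟.RelHomDGC := fun b X₁ X₂ _ _ => hHom X₁ X₂ (hhyp X₂)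
  exact ⟨𝒟, hF, fun b X _ t ht => ht.elim, hHomD,
    𝒟.relIsomDGC_of_relHomDGC (fun _ => F) hHomD⟩

/-- **The Rmk 5.10.1 (i) slot record is inhabited** at five copies of any category, all arrows the identity functor,
both homotopies the identity (the record carries no further law). [cite: MochizukiAbsTopIII2015, Rmk 5.10.1 (i) p.149] -/
theorem AbsTopIII.Rmk5101Setting.nonempty_self (C : Type u) [Category.{u} C] :
    Nonempty (AbsTopIII.Rmk5101Setting C C C C C) :=
  ⟨{ tele := 𝟭 C, lam := 𝟭 C, mono := 𝟭 C, long := 𝟭 C, psi := 𝟭 C, direct := 𝟭 C,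
     eta := Iso.refl _, coric := Iso.refl _ }⟩

end Literature.AnabelianGeometry.AbsoluteAnabelian
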